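import Mathlib.Analysis.SpecialFunctions.Pow.Real
import HarnessLib

/-!
# `NoHeavyLowerTail` (crux stmt-CriticalPhenomena-4575), abstract sunflower cubic: SAFETY IS PRESERVED BY ADDING A DISJOINT EDGE —
# the analytic half (the two-coin merging inequality)

Support file (seat `prim-ineq-prove-1` gen 43; `--supports stmt-CriticalPhenomena-4575`).  No `sorry`, no named facts.
Memo: run/shared/lean/prim/prim-ineq-prove-1/FINDING-COSTGAME-prove1-g43.md §5.

THE INEQUALITY.  Fix `a ∈ (0,1]` (the measure of the old core) and `s, t ∈ [0,1]` (the probabilities of the two new coordinates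
`y₁, y₂`).  For a petal `V` of the new core `A ∨ (y₁ ∧ y₂)` write `u, v, m` for the measures of its sections at the states
`10, 01, 00` of `(y₁, y₂)` and `x ≤ 1` for the state `11`; then `μ(V) = st·x + s(1−t)·u + (1−s)t·v + (1−s)(1−t)·m` with
`m ≤ min(u,v)` and `u, v ∈ [a, 1]`, and safety of the old core on the `10`- and `01`-sections gives `∏_j u_j ≤ a^(K−1)`,
`∏_j v_j ≤ a^(K−1)`.  With `U = u/a, V = v/a ∈ [1, 1/a]` every factor is at most
`gfun a s t U V = st + a·(s(1−t)U + (1−s)tV + (1−s)(1−t)·min(U,V))`, and the new core has measure `gfun a s t 1 1 = st + (1−st)a`.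
* **`gfun_merge`** (the 2-merge inequality): `gfun U₁ V₁ · gfun U₂ V₂ ≤ gfun 1 1 · gfun (U₁U₂) (V₁V₂)` for `U_i, V_i ∈ [1, 1/a]` —
  six sign cases, each an explicit sum of nonnegative products (e.g. for `U₁ ≤ V₁, U₂ ≤ V₂`:
  `RHS − LHS = st(1−t)a(U₁−1)(U₂−1) + st(1−s)ta(V₁−1)(V₂−1) + (1−t)a(1−s)ta(V₁−U₁)(V₂−U₂)`; the crossed cases use `aV ≤ 1`).
* **`prod_gfun_le`**: merging the blocks one at a time, `∏_j gfun U_j V_j ≤ (gfun 1 1)^(K−1) · gfun (∏U) (∏V) ≤ (gfun 1 1)^(K−1)`.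
* **`two_coin_prod_le`** (`a > 0`): `∏_j (st·x_j + s(1−t)u_j + (1−s)t v_j + (1−s)(1−t)m_j) ≤ (st + (1−st)a)^(K−1)`; the degenerate
  case `a = 0` (pairwise constraints only, merging by SUMS) is `two_coin_prod_le_zero` in `…SunflowerUnionEdgeAnalyticZero`.
The measure-theoretic half (`…SunflowerUnionEdge`) turns this into `Safe p A → Safe p (A ∪ {y₁, y₂ open})` and the graph
corollaries (an A-safe graph plus a disjoint edge / complete bipartite component is A-safe).  REMARK (memo §5): the naive
"two-level one-coin" version of this step (levels `u ≤ v` with only `∏u ≤ a^(K−1)`, `∏v ≤ b^(K−1)`) is FALSE for `K ≥ 3` — the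
structure `m ≤ min(u,v)`, top state `≡ 1` is exactly what makes the disjoint edge work.
-/

noncomputable section

namespace Summit.CriticalPhenomena.PercolationContinuityZ3.Theorems.SunflowerPartition

namespace SafeCalc

namespace UnionEdge

open Finset

/-! ## The two-coin profile function -/

/-- `gfun a s t U V = st + a·(s(1−t)·U + (1−s)t·V + (1−s)(1−t)·min U V)`: the largest possible measure of a petal of
`A ∨ (y₁∧y₂)` whose `10`/`01`-sections have measures `aU`, `aV`. [this work] -/
def gfun (a s t U V : ℝ) : ℝ := s * t + a * (s * (1 - t) * U + (1 - s) * t * V + (1 - s) * (1 - t) * min U V)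

/-- At `U = V = 1` the profile function is the measure `st + (1−st)a` of the new core. [this work] -/
theorem gfun_one_one (a s t : ℝ) : gfun a s t 1 1 = s * t + (1 - s * t) * a := by
  unfold gfun; rw [min_self]; ring

/-- At the top `U = V = 1/a` the profile function equals `1`. [this work] -/
theorem gfun_inv_inv {a : ℝ} (ha : a ≠ 0) (s t : ℝ) : gfun a s t a⁻¹ a⁻¹ = 1 := by
  unfold gfun; rw [min_self]; field_simp; ring

/-- The profile function is monotone in `U` and `V`. [this work] -/
theorem gfun_mono {a s t U V U' V' : ℝ} (ha : 0 ≤ a) (hs : 0 ≤ s) (hs1 : s ≤ 1) (ht : 0 ≤ t) (ht1 : t ≤ 1)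
    (hU : U ≤ U') (hV : V ≤ V') : gfun a s t U V ≤ gfun a s t U' V' := by
  unfold gfun
  have hmin : min U V ≤ min U' V' := min_le_min hU hV
  have h1 : s * (1 - t) * U ≤ s * (1 - t) * U' := mul_le_mul_of_nonneg_left hU (mul_nonneg hs (by linarith))
  have h2 : (1 - s) * t * V ≤ (1 - s) * t * V' := mul_le_mul_of_nonneg_left hV (mul_nonneg (by linarith) ht)
  have h3 : (1 - s) * (1 - t) * min U V ≤ (1 - s) * (1 - t) * min U' V' :=
    mul_le_mul_of_nonneg_left hmin (mul_nonneg (by linarith) (by linarith))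
  nlinarith [mul_le_mul_of_nonneg_left (add_le_add (add_le_add h1 h2) h3) ha]

/-- The profile function is at most one on the box `aU, aV ≤ 1`. [this work] -/
theorem gfun_le_one {a s t U V : ℝ} (ha : 0 < a) (hs : 0 ≤ s) (hs1 : s ≤ 1) (ht : 0 ≤ t) (ht1 : t ≤ 1)
    (hU : a * U ≤ 1) (hV : a * V ≤ 1) : gfun a s t U V ≤ 1 := by
  have hU' : U ≤ a⁻¹ := by rw [← one_div]; exact (le_div_iff₀' ha).2 hU
  have hV' : V ≤ a⁻¹ := by rw [← one_div]; exact (le_div_iff₀' ha).2 hV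
  calc gfun a s t U V ≤ gfun a s t a⁻¹ a⁻¹ := gfun_mono ha.le hs hs1 ht ht1 hU' hV'
    _ = 1 := gfun_inv_inv ha.ne' s t

/-- The profile function is nonnegative for `U, V ≥ 0`. [this work] -/
theorem gfun_nonneg {a s t U V : ℝ} (ha : 0 ≤ a) (hs : 0 ≤ s) (hs1 : s ≤ 1) (ht : 0 ≤ t) (ht1 : t ≤ 1)
    (hU : 0 ≤ U) (hV : 0 ≤ V) : 0 ≤ gfun a s t U V := by
  unfold gfun
  have : 0 ≤ min U V := le_min hU hV
  have h1 : 0 ≤ s * (1 - t) * U := mul_nonneg (mul_nonneg hs (by linarith)) hU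
  have h2 : 0 ≤ (1 - s) * t * V := mul_nonneg (mul_nonneg (by linarith) ht) hV
  have h3 : 0 ≤ (1 - s) * (1 - t) * min U V := mul_nonneg (mul_nonneg (by linarith) (by linarith)) this
  positivity

/-! ## The 2-merge inequality -/

/-- **The 2-merge inequality.**  For `U_i, V_i ∈ [1, 1/a]`:
`gfun U₁ V₁ · gfun U₂ V₂ ≤ gfun 1 1 · gfun (U₁U₂) (V₁V₂)` — merging two blocks into one costs at most a factor `gfun 1 1`
(= the measure of the core).  Six sign cases, each an explicit sum of nonnegative products. [this work] -/
theorem gfun_merge {a s t U₁ V₁ U₂ V₂ : ℝ} (ha : 0 ≤ a) (hs : 0 ≤ s) (hs1 : s ≤ 1) (ht : 0 ≤ t) (ht1 : t ≤ 1)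
    (hU₁ : 1 ≤ U₁) (hV₁ : 1 ≤ V₁) (hU₂ : 1 ≤ U₂) (hV₂ : 1 ≤ V₂)
    (hU₁' : a * U₁ ≤ 1) (hV₁' : a * V₁ ≤ 1) (hU₂' : a * U₂ ≤ 1) (hV₂' : a * V₂ ≤ 1) :
    gfun a s t U₁ V₁ * gfun a s t U₂ V₂ ≤ gfun a s t 1 1 * gfun a s t (U₁ * U₂) (V₁ * V₂) := by
  have hs' : 0 ≤ 1 - s := by linarith
  have ht' : 0 ≤ 1 - t := by linarith
  have hst : 0 ≤ s * t := mul_nonneg hs ht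
  have hQ : 0 ≤ (1 - s) * t * a := mul_nonneg (mul_nonneg hs' ht) ha
  have hP : 0 ≤ s * (1 - t) * a := mul_nonneg (mul_nonneg hs ht') ha
  have hPR : 0 ≤ (1 - t) * a := mul_nonneg ht' ha
  have hQR : 0 ≤ (1 - s) * a := mul_nonneg hs' ha
  have hR0 : 0 ≤ (1 - s) * (1 - t) * a := mul_nonneg (mul_nonneg hs' ht') ha
  have haV₁ : 0 ≤ 1 - a * V₁ := by linarith
  have haV₂ : 0 ≤ 1 - a * V₂ := by linarith
  have haU₁ : 0 ≤ 1 - a * U₁ := by linarith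
  have haU₂ : 0 ≤ 1 - a * U₂ := by linarith
  unfold gfun
  rw [min_self]
  rcases le_total U₁ V₁ with h1 | h1 <;> rcases le_total U₂ V₂ with h2 | h2
  · -- case 1: U₁ ≤ V₁, U₂ ≤ V₂, merged min = U₁U₂
    have hm : U₁ * U₂ ≤ V₁ * V₂ := mul_le_mul h1 h2 (by linarith) (by linarith)
    rw [min_eq_left h1, min_eq_left h2, min_eq_left hm]
    have e1 : 0 ≤ s * t * ((1 - t) * a) * ((U₁ - 1) * (U₂ - 1)) :=
      mul_nonneg (mul_nonneg hst hPR) (mul_nonneg (by linarith) (by linarith))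
    have e2 : 0 ≤ s * t * ((1 - s) * t * a) * ((V₁ - 1) * (V₂ - 1)) :=
      mul_nonneg (mul_nonneg hst hQ) (mul_nonneg (by linarith) (by linarith))
    have e3 : 0 ≤ (1 - t) * a * ((1 - s) * t * a) * ((V₁ - U₁) * (V₂ - U₂)) :=
      mul_nonneg (mul_nonneg hPR hQ) (mul_nonneg (by linarith) (by linarith))
    linarith [e1, e2, e3]
  · -- case 2: U₁ ≤ V₁, V₂ ≤ U₂
    rw [min_eq_left h1, min_eq_right h2]
    rcases le_total (U₁ * U₂) (V₁ * V₂) with hm | hm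
    · rw [min_eq_left hm]
      have e1 : 0 ≤ s * t * ((1 - t) * a) * ((U₁ - 1) * (U₂ - 1)) :=
        mul_nonneg (mul_nonneg hst hPR) (mul_nonneg (by linarith) (by linarith))
      have e2 : 0 ≤ s * t * ((1 - s) * t * a) * ((V₁ - 1) * (V₂ - 1)) :=
        mul_nonneg (mul_nonneg hst hQ) (mul_nonneg (by linarith) (by linarith))
      have e3 : 0 ≤ (U₂ - V₂) * ((1 - s) * (1 - t) * a) * (s * t * (1 - a * V₁)) :=
        mul_nonneg (mul_nonneg (by linarith) hR0) (mul_nonneg hst haV₁)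
      have e4 : 0 ≤ (U₂ - V₂) * ((1 - s) * (1 - t) * a) * (a * U₁) :=
        mul_nonneg (mul_nonneg (by linarith) hR0) (mul_nonneg ha (by linarith))
      linarith [e1, e2, e3, e4]
    · rw [min_eq_right hm]
      have e1 : 0 ≤ s * t * (s * (1 - t) * a) * ((U₁ - 1) * (U₂ - 1)) :=
        mul_nonneg (mul_nonneg hst hP) (mul_nonneg (by linarith) (by linarith))
      have e2 : 0 ≤ s * t * ((1 - s) * t * a) * ((V₁ - 1) * (V₂ - 1)) :=
        mul_nonneg (mul_nonneg hst hQ) (mul_nonneg (by linarith) (by linarith))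
      have e3 : 0 ≤ s * t * ((1 - s) * (1 - t) * a) * ((V₁ - 1) * (V₂ - 1)) :=
        mul_nonneg (mul_nonneg hst hR0) (mul_nonneg (by linarith) (by linarith))
      have e4 : 0 ≤ (V₁ - U₁) * ((1 - s) * (1 - t) * a) * (s * t * (1 - a * U₂)) :=
        mul_nonneg (mul_nonneg (by linarith) hR0) (mul_nonneg hst haU₂)
      have e5 : 0 ≤ (V₁ - U₁) * ((1 - s) * (1 - t) * a) * (a * V₂) :=
        mul_nonneg (mul_nonneg (by linarith) hR0) (mul_nonneg ha (by linarith))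
      linarith [e1, e2, e3, e4, e5]
  · -- case 3: V₁ ≤ U₁, U₂ ≤ V₂
    rw [min_eq_right h1, min_eq_left h2]
    rcases le_total (U₁ * U₂) (V₁ * V₂) with hm | hm
    · rw [min_eq_left hm]
      have e1 : 0 ≤ s * t * ((1 - t) * a) * ((U₂ - 1) * (U₁ - 1)) :=
        mul_nonneg (mul_nonneg hst hPR) (mul_nonneg (by linarith) (by linarith))
      have e2 : 0 ≤ s * t * ((1 - s) * t * a) * ((V₂ - 1) * (V₁ - 1)) :=
        mul_nonneg (mul_nonneg hst hQ) (mul_nonneg (by linarith) (by linarith))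
      have e3 : 0 ≤ (U₁ - V₁) * ((1 - s) * (1 - t) * a) * (s * t * (1 - a * V₂)) :=
        mul_nonneg (mul_nonneg (by linarith) hR0) (mul_nonneg hst haV₂)
      have e4 : 0 ≤ (U₁ - V₁) * ((1 - s) * (1 - t) * a) * (a * U₂) :=
        mul_nonneg (mul_nonneg (by linarith) hR0) (mul_nonneg ha (by linarith))
      linarith [e1, e2, e3, e4]
    · rw [min_eq_right hm]
      have e1 : 0 ≤ s * t * (s * (1 - t) * a) * ((U₂ - 1) * (U₁ - 1)) :=
        mul_nonneg (mul_nonneg hst hP) (mul_nonneg (by linarith) (by linarith))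
      have e2 : 0 ≤ s * t * ((1 - s) * t * a) * ((V₂ - 1) * (V₁ - 1)) :=
        mul_nonneg (mul_nonneg hst hQ) (mul_nonneg (by linarith) (by linarith))
      have e3 : 0 ≤ s * t * ((1 - s) * (1 - t) * a) * ((V₂ - 1) * (V₁ - 1)) :=
        mul_nonneg (mul_nonneg hst hR0) (mul_nonneg (by linarith) (by linarith))
      have e4 : 0 ≤ (V₂ - U₂) * ((1 - s) * (1 - t) * a) * (s * t * (1 - a * U₁)) :=
        mul_nonneg (mul_nonneg (by linarith) hR0) (mul_nonneg hst haU₁)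
      have e5 : 0 ≤ (V₂ - U₂) * ((1 - s) * (1 - t) * a) * (a * V₁) :=
        mul_nonneg (mul_nonneg (by linarith) hR0) (mul_nonneg ha (by linarith))
      linarith [e1, e2, e3, e4, e5]
  · -- case 4: V₁ ≤ U₁, V₂ ≤ U₂, merged min = V₁V₂
    have hm : V₁ * V₂ ≤ U₁ * U₂ := mul_le_mul h1 h2 (by linarith) (by linarith)
    rw [min_eq_right h1, min_eq_right h2, min_eq_right hm]
    have e1 : 0 ≤ s * t * ((1 - s) * a) * ((V₁ - 1) * (V₂ - 1)) :=
      mul_nonneg (mul_nonneg hst hQR) (mul_nonneg (by linarith) (by linarith))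
    have e2 : 0 ≤ s * t * (s * (1 - t) * a) * ((U₁ - 1) * (U₂ - 1)) :=
      mul_nonneg (mul_nonneg hst hP) (mul_nonneg (by linarith) (by linarith))
    have e3 : 0 ≤ (1 - s) * a * (s * (1 - t) * a) * ((U₁ - V₁) * (U₂ - V₂)) :=
      mul_nonneg (mul_nonneg hQR hP) (mul_nonneg (by linarith) (by linarith))
    linarith [e1, e2, e3]

/-! ## Merging all blocks -/

/-- **Merging induction.**  For a nonempty family of blocks `(U_j, V_j)` in `[1, ∞)` with `a·∏U ≤ 1`, `a·∏V ≤ 1`: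
`∏_j gfun U_j V_j ≤ (gfun 1 1)^(#S − 1) · gfun (∏_j U_j) (∏_j V_j)`. [this work] -/
theorem prod_gfun_le_merged {κ : Type*} [DecidableEq κ] {a s t : ℝ} (ha : 0 < a) (hs : 0 ≤ s) (hs1 : s ≤ 1)
    (ht : 0 ≤ t) (ht1 : t ≤ 1) (U V : κ → ℝ) :
    ∀ S : Finset κ, S.Nonempty → (∀ j ∈ S, 1 ≤ U j) → (∀ j ∈ S, 1 ≤ V j) →
      a * ∏ j ∈ S, U j ≤ 1 → a * ∏ j ∈ S, V j ≤ 1 →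
      ∏ j ∈ S, gfun a s t (U j) (V j) ≤ gfun a s t 1 1 ^ (S.card - 1) * gfun a s t (∏ j ∈ S, U j) (∏ j ∈ S, V j) := by
  intro S hS
  induction hS using Finset.Nonempty.cons_induction with
  | singleton i =>
    intro _ _ _ _
    simp
  | cons i S hi hS ih =>
    intro hU hV hpU hpV
    rw [prod_cons, prod_cons, prod_cons, card_cons] at *
    have hUi : 1 ≤ U i := hU i (mem_cons_self i S)
    have hVi : 1 ≤ V i := hV i (mem_cons_self i S)
    have hUS : ∀ j ∈ S, 1 ≤ U j := fun j hj => hU j (mem_cons_of_mem hj)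
    have hVS : ∀ j ∈ S, 1 ≤ V j := fun j hj => hV j (mem_cons_of_mem hj)
    have hPU : 1 ≤ ∏ j ∈ S, U j := by
      have := Finset.prod_le_prod (s := S) (fun j _ => zero_le_one) hUS; simpa using this
    have hPV : 1 ≤ ∏ j ∈ S, V j := by
      have := Finset.prod_le_prod (s := S) (fun j _ => zero_le_one) hVS; simpa using this
    have hP0 : 0 ≤ ∏ j ∈ S, U j := zero_le_one.trans hPU
    have hQ0 : 0 ≤ ∏ j ∈ S, V j := zero_le_one.trans hPV
    have hpU' : a * ∏ j ∈ S, U j ≤ 1 :=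
      le_trans (by nlinarith [mul_nonneg (mul_nonneg ha.le hP0) (sub_nonneg.2 hUi)]) hpU
    have hpV' : a * ∏ j ∈ S, V j ≤ 1 :=
      le_trans (by nlinarith [mul_nonneg (mul_nonneg ha.le hQ0) (sub_nonneg.2 hVi)]) hpV
    have hUi' : a * U i ≤ 1 :=
      le_trans (by nlinarith [mul_nonneg (mul_nonneg ha.le (zero_le_one.trans hUi)) (sub_nonneg.2 hPU)]) hpU
    have hVi' : a * V i ≤ 1 :=
      le_trans (by nlinarith [mul_nonneg (mul_nonneg ha.le (zero_le_one.trans hVi)) (sub_nonneg.2 hPV)]) hpV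
    have IH := ih hUS hVS hpU' hpV'
    have hgi : 0 ≤ gfun a s t (U i) (V i) := gfun_nonneg ha.le hs hs1 ht ht1 (by linarith) (by linarith)
    have hc : 0 ≤ gfun a s t 1 1 := gfun_nonneg ha.le hs hs1 ht ht1 zero_le_one zero_le_one
    have hmerge := gfun_merge ha.le hs hs1 ht ht1 hUi hVi hPU hPV hUi' hVi' hpU' hpV'
    have hcard : S.card + 1 - 1 = (S.card - 1) + 1 := by
      have := hS.card_pos; omega
    calc gfun a s t (U i) (V i) * ∏ j ∈ S, gfun a s t (U j) (V j)
        ≤ gfun a s t (U i) (V i) * (gfun a s t 1 1 ^ (S.card - 1) * gfun a s t (∏ j ∈ S, U j) (∏ j ∈ S, V j)) :=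
          mul_le_mul_of_nonneg_left IH hgi
      _ = gfun a s t 1 1 ^ (S.card - 1) * (gfun a s t (U i) (V i) * gfun a s t (∏ j ∈ S, U j) (∏ j ∈ S, V j)) := by
          ring
      _ ≤ gfun a s t 1 1 ^ (S.card - 1) * (gfun a s t 1 1 * gfun a s t (U i * ∏ j ∈ S, U j) (V i * ∏ j ∈ S, V j)) :=
          mul_le_mul_of_nonneg_left hmerge (pow_nonneg hc _)
      _ = gfun a s t 1 1 ^ (S.card + 1 - 1) * gfun a s t (U i * ∏ j ∈ S, U j) (V i * ∏ j ∈ S, V j) := by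
          rw [hcard, pow_succ]; ring

/-- **The merged bound**: under the same hypotheses `∏_j gfun U_j V_j ≤ (st + (1−st)a)^(#S−1)`. [this work] -/
theorem prod_gfun_le {κ : Type*} [DecidableEq κ] {a s t : ℝ} (ha : 0 < a) (hs : 0 ≤ s) (hs1 : s ≤ 1) (ht : 0 ≤ t)
    (ht1 : t ≤ 1) (U V : κ → ℝ) (S : Finset κ) (hU : ∀ j ∈ S, 1 ≤ U j) (hV : ∀ j ∈ S, 1 ≤ V j)
    (hpU : a * ∏ j ∈ S, U j ≤ 1) (hpV : a * ∏ j ∈ S, V j ≤ 1) :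
    ∏ j ∈ S, gfun a s t (U j) (V j) ≤ (s * t + (1 - s * t) * a) ^ (S.card - 1) := by
  rcases S.eq_empty_or_nonempty with h | h
  · rw [h]; simp
  have h1 := prod_gfun_le_merged ha hs hs1 ht ht1 U V S h hU hV hpU hpV
  have h2 : gfun a s t (∏ j ∈ S, U j) (∏ j ∈ S, V j) ≤ 1 := gfun_le_one ha hs hs1 ht ht1 hpU hpV
  have hc : 0 ≤ gfun a s t 1 1 := gfun_nonneg ha.le hs hs1 ht ht1 zero_le_one zero_le_one
  rw [← gfun_one_one]
  calc ∏ j ∈ S, gfun a s t (U j) (V j) ≤ gfun a s t 1 1 ^ (S.card - 1) * gfun a s t (∏ j ∈ S, U j) (∏ j ∈ S, V j) := h1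
    _ ≤ gfun a s t 1 1 ^ (S.card - 1) * 1 := mul_le_mul_of_nonneg_left h2 (pow_nonneg hc _)
    _ = gfun a s t 1 1 ^ (S.card - 1) := mul_one _

/-! ## The two-coin bound, `a > 0` -/

/-- **Two-coin bound (`a > 0`).**  If `x_j ∈ [0,1]`, `u_j, v_j ∈ [a,1]`, `0 ≤ m_j ≤ min(u_j, v_j)` and
`∏ u_j ≤ a^(n−1)`, `∏ v_j ≤ a^(n−1)`, then `∏_j (st·x_j + s(1−t)u_j + (1−s)t·v_j + (1−s)(1−t)m_j) ≤ (st + (1−st)a)^(n−1)`. [this work] -/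
theorem two_coin_prod_le {n : ℕ} {a s t : ℝ} (ha : 0 < a) (hs : 0 ≤ s) (hs1 : s ≤ 1) (ht : 0 ≤ t) (ht1 : t ≤ 1)
    (x u v m : Fin n → ℝ) (hx0 : ∀ j, 0 ≤ x j) (hx1 : ∀ j, x j ≤ 1) (hua : ∀ j, a ≤ u j) (hu1 : ∀ j, u j ≤ 1)
    (hva : ∀ j, a ≤ v j) (hv1 : ∀ j, v j ≤ 1) (hm0 : ∀ j, 0 ≤ m j) (hmu : ∀ j, m j ≤ u j) (hmv : ∀ j, m j ≤ v j)
    (hpu : ∏ j, u j ≤ a ^ (n - 1)) (hpv : ∏ j, v j ≤ a ^ (n - 1)) :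
    ∏ j, (s * t * x j + s * (1 - t) * u j + (1 - s) * t * v j + (1 - s) * (1 - t) * m j) ≤
      (s * t + (1 - s * t) * a) ^ (n - 1) := by
  classical
  rcases Nat.eq_zero_or_pos n with hn | hn
  · subst hn; simp
  have hs' : 0 ≤ 1 - s := by linarith
  have ht' : 0 ≤ 1 - t := by linarith
  -- each factor is at most `gfun a s t (u/a) (v/a)`
  have hfac : ∀ j, s * t * x j + s * (1 - t) * u j + (1 - s) * t * v j + (1 - s) * (1 - t) * m j ≤
      gfun a s t (u j / a) (v j / a) := by
    intro j
    unfold gfun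
    have hmin : m j ≤ a * min (u j / a) (v j / a) := by
      have : a * min (u j / a) (v j / a) = min (u j) (v j) := by
        rw [mul_min_of_nonneg _ _ ha.le, mul_div_cancel₀ _ ha.ne', mul_div_cancel₀ _ ha.ne']
      rw [this]
      exact le_min (hmu j) (hmv j)
    have e1 : s * t * x j ≤ s * t := by nlinarith [hx1 j, mul_nonneg hs ht]
    have e2 : a * (s * (1 - t) * (u j / a)) = s * (1 - t) * u j := by field_simp
    have e3 : a * ((1 - s) * t * (v j / a)) = (1 - s) * t * v j := by field_simp
    have e4 : (1 - s) * (1 - t) * m j ≤ a * ((1 - s) * (1 - t) * min (u j / a) (v j / a)) := by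
      have := mul_le_mul_of_nonneg_left hmin (mul_nonneg hs' ht')
      linarith [this]
    linarith [e1, e2, e3, e4]
  have hfac0 : ∀ j, 0 ≤ s * t * x j + s * (1 - t) * u j + (1 - s) * t * v j + (1 - s) * (1 - t) * m j := by
    intro j
    have : 0 ≤ u j := ha.le.trans (hua j)
    have : 0 ≤ v j := ha.le.trans (hva j)
    have := hx0 j; have := hm0 j
    positivity
  have hU : ∀ j ∈ (univ : Finset (Fin n)), 1 ≤ u j / a := fun j _ => by rw [le_div_iff₀ ha, one_mul]; exact hua j
  have hV : ∀ j ∈ (univ : Finset (Fin n)), 1 ≤ v j / a := fun j _ => by rw [le_div_iff₀ ha, one_mul]; exact hva j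
  have hpow : a ^ n = a * a ^ (n - 1) := by
    conv_lhs => rw [show n = (n - 1) + 1 by omega, pow_succ]
    ring
  have hpU : a * ∏ j, u j / a ≤ 1 := by
    rw [prod_div_distrib, prod_const, card_univ, Fintype.card_fin, hpow]
    rw [mul_div_assoc', div_le_one (by positivity)]
    exact mul_le_mul_of_nonneg_left hpu ha.le
  have hpV : a * ∏ j, v j / a ≤ 1 := by
    rw [prod_div_distrib, prod_const, card_univ, Fintype.card_fin, hpow]
    rw [mul_div_assoc', div_le_one (by positivity)]
    exact mul_le_mul_of_nonneg_left hpv ha.le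
  have key := prod_gfun_le ha hs hs1 ht ht1 (fun j => u j / a) (fun j => v j / a) univ hU hV hpU hpV
  rw [card_univ, Fintype.card_fin] at key
  exact le_trans (prod_le_prod (fun j _ => hfac0 j) fun j _ => hfac j) key

end UnionEdge

end SafeCalc

end Summit.CriticalPhenomena.PercolationContinuityZ3.Theorems.SunflowerPartition
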